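import Mathlib.Topology.Order.IntermediateValue
import Literature.Analysis.ODE.SoninEnvelope
import Literature.Analysis.ODE.SoninPiecewise
import Literature.Analysis.ODE.TransitionZoneGrowth
import HarnessLib

/-!
# Transport of the `η`-energy of `u″ = −φ u` across a tame zone `−η² ≤ φ ≤ Φ`

Topic `Literature/Analysis/ODE` (namespace `Literature.Analysis.ODE`). A priori TWO-SIDED control
of complex solutions of `u″ = −φ(x) u` (`φ` real, differentiable) through a zone on which the
coefficient is only known to satisfy `−η² ≤ φ ≤ Φ` (`0 < η`, `η² ≤ Φ`) and to be piecewise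
monotone: no deep classically forbidden sub-zone, but `φ` may be small, vanish or change sign
(turning points, shallow barriers), so neither the oscillatory (Sonin–Pólya) nor the exponential
regime applies throughout. The quantity transported is the `η`-energy `E = η²|u|² + |u′|²`.

* `etaEnergy_le_exp_mul_of_abs_le` — a COLLAR `|φ| ≤ η²`: `E(y) ≤ e^{2η|y − x|} E(x)`
  (`zoneEnergy_le_zoneEnergy_mul_exp` of `TransitionZoneGrowth.lean` with `Kₑ = η`, `q = −φ`).
* `etaEnergy_le_sq_mul_of_sq_le` — a BLOCK `η² ≤ φ ≤ Φ` with `φ` monotone: `E(y) ≤ (Φ/η²)² E(x)`,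
  since `E ≤ T ≤ (Φ/η²) E` for the Sonin–Pólya energy `T = φ|u|² + |u′|²` and
  `T(y) ≤ (Φ/η²) T(x)` (`soninEnergy_le_mul_ratio` of `SoninPiecewise.lean`).
* `etaEnergy_le_of_monotoneOn_or_antitoneOn` — ONE monotone piece `[α, β]`:
  `E(y) ≤ (Φ/η²)² e^{2η(β − α)} E(x)` for all `x, y ∈ [α, β]`; the two points are joined through
  a junction `s` between them with `φ(s) = η²` (intermediate value theorem), a collar on one side
  and a block on the other (on a monotone piece the level sets `{φ ≤ η²}`, `{φ ≥ η²}` are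
  intervals).
* `tameZone_transport` — a partition `t 0 ≤ t 1 ≤ ⋯ ≤ t k` with `φ` monotone on each
  `[t i, t (i+1)]`: `E(y) ≤ (Φ/η²)^{2k} e^{2η(t k − t 0)} E(x)` for all `x, y ∈ [t 0, t k]`, by
  induction on the number of pieces through the partition points (the pattern of
  `soninEnergy_le_pow_ratio`).

Hypotheses are pointwise `HasDerivAt` statements on closed intervals for `u, u′ : ℝ → ℂ` and
`φ, φ′ : ℝ → ℝ`, as in `SoninEnvelope.lean` / `SoninPiecewise.lean`. Everything is proved. Used
toward the cone Green-kernel bound of the near-extremal Kerr programme (a priori envelopes of the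
horizon / infinity solutions of Carter's radial ODE between the horizon, resp. the far zone, and
the barrier, with `η ≍ δκ`).

## References
* P. Hartman, *Ordinary Differential Equations*, Classics in Applied Mathematics 38 (SIAM 2002),
  Ch. IV §1, Lemma 1.1 (a priori exponential bounds for linear systems). Key `Hartman2002`.
* G. Szegő, *Orthogonal Polynomials*, AMS Colloquium Publ. 23, 4th ed. (1975), §7.31,
  Theorem 7.31.1 (Sonin–Pólya).
-/

noncomputable section

open Set Filter Topology

namespace Literature.Analysis.ODE

/-! ### Values of a monotone-or-antitone function between two points -/

/-- If `φ` is monotone or antitone on `[α, β]`, an upper bound for `φ` at two points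
`x, y ∈ [α, β]` bounds `φ` on the whole unordered interval between them. [folklore] -/
theorem le_of_mem_uIcc_of_monotoneOn_or_antitoneOn {φ : ℝ → ℝ} {α β : ℝ}
    (hmono : MonotoneOn φ (Icc α β) ∨ AntitoneOn φ (Icc α β)) {x y z c : ℝ}
    (hx : x ∈ Icc α β) (hy : y ∈ Icc α β) (hz : z ∈ uIcc x y) (hxc : φ x ≤ c)
    (hyc : φ y ≤ c) : φ z ≤ c := by
  have hzS : z ∈ Icc α β := uIcc_subset_Icc hx hy hz
  rcases le_total x y with h | h
  · rw [uIcc_of_le h] at hz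
    rcases hmono with hmn | han
    · exact (hmn hzS hy hz.2).trans hyc
    · exact (han hx hzS hz.1).trans hxc
  · rw [uIcc_of_ge h] at hz
    rcases hmono with hmn | han
    · exact (hmn hzS hx hz.2).trans hxc
    · exact (han hy hzS hz.1).trans hyc

/-- If `φ` is monotone or antitone on `[α, β]`, a lower bound for `φ` at two points
`x, y ∈ [α, β]` bounds `φ` from below on the whole unordered interval between them. [folklore] -/
theorem ge_of_mem_uIcc_of_monotoneOn_or_antitoneOn {φ : ℝ → ℝ} {α β : ℝ}
    (hmono : MonotoneOn φ (Icc α β) ∨ AntitoneOn φ (Icc α β)) {x y z c : ℝ}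
    (hx : x ∈ Icc α β) (hy : y ∈ Icc α β) (hz : z ∈ uIcc x y) (hxc : c ≤ φ x)
    (hyc : c ≤ φ y) : c ≤ φ z := by
  have hzS : z ∈ Icc α β := uIcc_subset_Icc hx hy hz
  rcases le_total x y with h | h
  · rw [uIcc_of_le h] at hz
    rcases hmono with hmn | han
    · exact hxc.trans (hmn hx hzS hz.1)
    · exact hyc.trans (han hzS hy hz.2)
  · rw [uIcc_of_ge h] at hz
    rcases hmono with hmn | han
    · exact hyc.trans (hmn hy hzS hz.1)
    · exact hxc.trans (han hzS hx hz.2)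

/-! ### A collar: `|φ| ≤ η²` -/

/-- **Collar transport.** If `u″ = −φ u` on the unordered interval between `x` and `y` and
`|φ| ≤ η²` there (`η ≥ 0`), then the `η`-energy `E = η²|u|² + |u′|²` satisfies
`E(y) ≤ e^{2η|y − x|} E(x)`: Hartman's a priori bound `zoneEnergy_le_zoneEnergy_mul_exp` for
`y″ = q y`, `q = −φ`, `‖q‖ ≤ η²`, in the `η`-weighted norm. [folklore] -/
theorem etaEnergy_le_exp_mul_of_abs_le {u u' : ℝ → ℂ} {φ : ℝ → ℝ} {η x y : ℝ} (hη : 0 ≤ η)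
    (hu : ∀ z ∈ uIcc x y, HasDerivAt u (u' z) z ∧ HasDerivAt u' (-((φ z : ℂ) * u z)) z)
    (hbd : ∀ z ∈ uIcc x y, |φ z| ≤ η ^ 2) :
    η ^ 2 * ‖u y‖ ^ 2 + ‖u' y‖ ^ 2 ≤
      Real.exp (2 * η * |y - x|) * (η ^ 2 * ‖u x‖ ^ 2 + ‖u' x‖ ^ 2) := by
  have hu' : ∀ z ∈ uIcc x y, HasDerivAt u (u' z) z ∧
      HasDerivAt u' ((fun w => -(φ w : ℂ)) z * u z) z :=
    fun z hz => ⟨(hu z hz).1, by rw [neg_mul]; exact (hu z hz).2⟩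
  have hq : ∀ z ∈ uIcc x y, ‖(fun w => -(φ w : ℂ)) z‖ ≤ η ^ 2 := fun z hz => by
    rw [norm_neg, Complex.norm_real, Real.norm_eq_abs]
    exact hbd z hz
  exact (zoneEnergy_le_zoneEnergy_mul_exp hη hu' hq left_mem_uIcc right_mem_uIcc).trans_eq
    (mul_comm _ _)

/-! ### A block: `η² ≤ φ ≤ Φ` with `φ` monotone -/

/-- **Block transport.** If `u″ = −φ u` on the unordered interval between `x` and `y`, with `φ`
differentiable, monotone or antitone, and `η² ≤ φ ≤ Φ` there (`η > 0`), then
`E(y) ≤ (Φ/η²)² E(x)` for the `η`-energy `E = η²|u|² + |u′|²`: indeed `E ≤ T ≤ (Φ/η²) E` for the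
Sonin–Pólya energy `T = φ|u|² + |u′|²`, and `T(y) ≤ (Φ/η²) T(x)` across one monotone stretch
(`soninEnergy_le_mul_ratio`). [folklore] -/
theorem etaEnergy_le_sq_mul_of_sq_le {u u' : ℝ → ℂ} {φ φ' : ℝ → ℝ} {η Φ x y : ℝ} (hη : 0 < η)
    (hu : ∀ z ∈ uIcc x y, HasDerivAt u (u' z) z ∧ HasDerivAt u' (-((φ z : ℂ) * u z)) z)
    (hφ : ∀ z ∈ uIcc x y, HasDerivAt φ (φ' z) z)
    (hmono : MonotoneOn φ (uIcc x y) ∨ AntitoneOn φ (uIcc x y))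
    (hbd : ∀ z ∈ uIcc x y, η ^ 2 ≤ φ z ∧ φ z ≤ Φ) :
    η ^ 2 * ‖u y‖ ^ 2 + ‖u' y‖ ^ 2 ≤ (Φ / η ^ 2) ^ 2 * (η ^ 2 * ‖u x‖ ^ 2 + ‖u' x‖ ^ 2) := by
  have hη2 : 0 < η ^ 2 := pow_pos hη 2
  have hT : φ y * ‖u y‖ ^ 2 + ‖u' y‖ ^ 2 ≤ Φ / η ^ 2 * (φ x * ‖u x‖ ^ 2 + ‖u' x‖ ^ 2) :=
    soninEnergy_le_mul_ratio hu hφ hmono hη2 hbd left_mem_uIcc right_mem_uIcc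
  have hx := hbd x left_mem_uIcc
  have hy := hbd y right_mem_uIcc
  have hR : 1 ≤ Φ / η ^ 2 := (one_le_div hη2).2 (hx.1.trans hx.2)
  have h1 : η ^ 2 * ‖u y‖ ^ 2 + ‖u' y‖ ^ 2 ≤ φ y * ‖u y‖ ^ 2 + ‖u' y‖ ^ 2 := by
    have := mul_le_mul_of_nonneg_right hy.1 (sq_nonneg ‖u y‖)
    linarith
  have h2 : φ x * ‖u x‖ ^ 2 + ‖u' x‖ ^ 2 ≤ Φ / η ^ 2 * (η ^ 2 * ‖u x‖ ^ 2 + ‖u' x‖ ^ 2) := by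
    have e : Φ / η ^ 2 * (η ^ 2 * ‖u x‖ ^ 2 + ‖u' x‖ ^ 2) =
        Φ * ‖u x‖ ^ 2 + Φ / η ^ 2 * ‖u' x‖ ^ 2 := by
      field_simp
    rw [e]
    have h3 : φ x * ‖u x‖ ^ 2 ≤ Φ * ‖u x‖ ^ 2 := mul_le_mul_of_nonneg_right hx.2 (sq_nonneg _)
    have h4 : ‖u' x‖ ^ 2 ≤ Φ / η ^ 2 * ‖u' x‖ ^ 2 := le_mul_of_one_le_left (sq_nonneg _) hR
    linarith
  calc η ^ 2 * ‖u y‖ ^ 2 + ‖u' y‖ ^ 2 ≤ φ y * ‖u y‖ ^ 2 + ‖u' y‖ ^ 2 := h1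
    _ ≤ Φ / η ^ 2 * (φ x * ‖u x‖ ^ 2 + ‖u' x‖ ^ 2) := hT
    _ ≤ Φ / η ^ 2 * (Φ / η ^ 2 * (η ^ 2 * ‖u x‖ ^ 2 + ‖u' x‖ ^ 2)) :=
      mul_le_mul_of_nonneg_left h2 (zero_le_one.trans hR)
    _ = (Φ / η ^ 2) ^ 2 * (η ^ 2 * ‖u x‖ ^ 2 + ‖u' x‖ ^ 2) := by ring

/-! ### One monotone piece -/

/-- **One tame monotone piece.** Let `u″ = −φ u` on `[α, β]` with `φ` differentiable, monotone
or antitone there, and `−η² ≤ φ ≤ Φ` (`0 < η`, `η² ≤ Φ`). Then for ANY two points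
`x, y ∈ [α, β]` the `η`-energy `E = η²|u|² + |u′|²` satisfies
`E(y) ≤ (Φ/η²)² · e^{2η(β − α)} · E(x)`. If `φ ≤ η²` at both points, the stretch between them
is a collar (`|φ| ≤ η²`, `etaEnergy_le_exp_mul_of_abs_le`); if `φ ≥ η²` at both, it is a block
(`etaEnergy_le_sq_mul_of_sq_le`); otherwise the intermediate value theorem gives a junction `s`
between them with `φ(s) = η²`, and the two bounds are chained through `s` (both factors are
`≥ 1`). [folklore] -/
theorem etaEnergy_le_of_monotoneOn_or_antitoneOn {u u' : ℝ → ℂ} {φ φ' : ℝ → ℝ} {α β η Φ : ℝ}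
    (hu : ∀ x ∈ Icc α β, HasDerivAt u (u' x) x ∧ HasDerivAt u' (-((φ x : ℂ) * u x)) x)
    (hφ : ∀ x ∈ Icc α β, HasDerivAt φ (φ' x) x)
    (hmono : MonotoneOn φ (Icc α β) ∨ AntitoneOn φ (Icc α β))
    (hη : 0 < η) (hΦ : η ^ 2 ≤ Φ) (hbd : ∀ x ∈ Icc α β, -η ^ 2 ≤ φ x ∧ φ x ≤ Φ) {x y : ℝ}
    (hx : x ∈ Icc α β) (hy : y ∈ Icc α β) :
    η ^ 2 * ‖u y‖ ^ 2 + ‖u' y‖ ^ 2 ≤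
      (Φ / η ^ 2) ^ 2 * Real.exp (2 * η * (β - α)) * (η ^ 2 * ‖u x‖ ^ 2 + ‖u' x‖ ^ 2) := by
  have hR : 1 ≤ Φ / η ^ 2 := (one_le_div (pow_pos hη 2)).2 hΦ
  have hR2 : 1 ≤ (Φ / η ^ 2) ^ 2 := one_le_pow₀ hR
  have hR0 : 0 ≤ (Φ / η ^ 2) ^ 2 := zero_le_one.trans hR2
  have hE0 : ∀ z, 0 ≤ η ^ 2 * ‖u z‖ ^ 2 + ‖u' z‖ ^ 2 := fun z => by positivity
  have hexp1 : 1 ≤ Real.exp (2 * η * (β - α)) :=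
    Real.one_le_exp (mul_nonneg (by positivity) (sub_nonneg.2 (hx.1.trans hx.2)))
  -- distances inside the piece are at most its length
  have hdist : ∀ a ∈ Icc α β, ∀ b ∈ Icc α β,
      Real.exp (2 * η * |b - a|) ≤ Real.exp (2 * η * (β - α)) := by
    intro a ha b hb
    have hab : |b - a| ≤ β - α :=
      abs_sub_le_iff.2 ⟨by linarith [hb.2, ha.1], by linarith [ha.2, hb.1]⟩
    exact Real.exp_le_exp.2 (mul_le_mul_of_nonneg_left hab (by positivity))
  -- a collar between two points where `φ ≤ η²`
  have hA : ∀ a ∈ Icc α β, ∀ b ∈ Icc α β, φ a ≤ η ^ 2 → φ b ≤ η ^ 2 →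
      η ^ 2 * ‖u b‖ ^ 2 + ‖u' b‖ ^ 2 ≤
        Real.exp (2 * η * (β - α)) * (η ^ 2 * ‖u a‖ ^ 2 + ‖u' a‖ ^ 2) := by
    intro a ha b hb hac hbc
    have hsub : uIcc a b ⊆ Icc α β := uIcc_subset_Icc ha hb
    have h := etaEnergy_le_exp_mul_of_abs_le hη.le (fun z hz => hu z (hsub hz))
      (fun z hz => abs_le.2 ⟨by linarith [(hbd z (hsub hz)).1],
        le_of_mem_uIcc_of_monotoneOn_or_antitoneOn hmono ha hb hz hac hbc⟩)
    exact h.trans (mul_le_mul_of_nonneg_right (hdist a ha b hb) (hE0 a))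
  -- a block between two points where `η² ≤ φ`
  have hB : ∀ a ∈ Icc α β, ∀ b ∈ Icc α β, η ^ 2 ≤ φ a → η ^ 2 ≤ φ b →
      η ^ 2 * ‖u b‖ ^ 2 + ‖u' b‖ ^ 2 ≤ (Φ / η ^ 2) ^ 2 * (η ^ 2 * ‖u a‖ ^ 2 + ‖u' a‖ ^ 2) := by
    intro a ha b hb hac hbc
    have hsub : uIcc a b ⊆ Icc α β := uIcc_subset_Icc ha hb
    exact etaEnergy_le_sq_mul_of_sq_le hη (fun z hz => hu z (hsub hz))
      (fun z hz => hφ z (hsub hz)) (hmono.imp (fun h => h.mono hsub) fun h => h.mono hsub)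
      fun z hz => ⟨ge_of_mem_uIcc_of_monotoneOn_or_antitoneOn hmono ha hb hz hac hbc,
        (hbd z (hsub hz)).2⟩
  -- a junction between two points on opposite sides of the level `η²`
  have hcont : ContinuousOn φ (Icc α β) := fun z hz => (hφ z hz).continuousAt.continuousWithinAt
  have hJ : ∀ a ∈ Icc α β, ∀ b ∈ Icc α β, φ a ≤ η ^ 2 → η ^ 2 ≤ φ b →
      ∃ s ∈ uIcc a b, φ s = η ^ 2 := by
    intro a ha b hb hac hbc
    exact intermediate_value_uIcc (hcont.mono (uIcc_subset_Icc ha hb)) (mem_uIcc_of_le hac hbc)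
  rcases le_total (φ x) (η ^ 2) with hxc | hxc <;> rcases le_total (φ y) (η ^ 2) with hyc | hyc
  · -- collar–collar
    calc η ^ 2 * ‖u y‖ ^ 2 + ‖u' y‖ ^ 2
        ≤ Real.exp (2 * η * (β - α)) * (η ^ 2 * ‖u x‖ ^ 2 + ‖u' x‖ ^ 2) := hA x hx y hy hxc hyc
      _ ≤ (Φ / η ^ 2) ^ 2 * Real.exp (2 * η * (β - α)) * (η ^ 2 * ‖u x‖ ^ 2 + ‖u' x‖ ^ 2) :=
        mul_le_mul_of_nonneg_right (le_mul_of_one_le_left (Real.exp_pos _).le hR2) (hE0 x)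
  · -- `x` in the collar, `y` in the block: through a junction `s`
    obtain ⟨s, hs, hse⟩ := hJ x hx y hy hxc hyc
    have hsS : s ∈ Icc α β := uIcc_subset_Icc hx hy hs
    calc η ^ 2 * ‖u y‖ ^ 2 + ‖u' y‖ ^ 2
        ≤ (Φ / η ^ 2) ^ 2 * (η ^ 2 * ‖u s‖ ^ 2 + ‖u' s‖ ^ 2) := hB s hsS y hy hse.ge hyc
      _ ≤ (Φ / η ^ 2) ^ 2 *
          (Real.exp (2 * η * (β - α)) * (η ^ 2 * ‖u x‖ ^ 2 + ‖u' x‖ ^ 2)) :=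
        mul_le_mul_of_nonneg_left (hA x hx s hsS hxc hse.le) hR0
      _ = (Φ / η ^ 2) ^ 2 * Real.exp (2 * η * (β - α)) * (η ^ 2 * ‖u x‖ ^ 2 + ‖u' x‖ ^ 2) := by
        ring
  · -- `x` in the block, `y` in the collar: through a junction `s`
    obtain ⟨s, hs, hse⟩ := hJ y hy x hx hyc hxc
    have hsS : s ∈ Icc α β := uIcc_subset_Icc hy hx hs
    calc η ^ 2 * ‖u y‖ ^ 2 + ‖u' y‖ ^ 2
        ≤ Real.exp (2 * η * (β - α)) * (η ^ 2 * ‖u s‖ ^ 2 + ‖u' s‖ ^ 2) :=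
          hA s hsS y hy hse.le hyc
      _ ≤ Real.exp (2 * η * (β - α)) *
          ((Φ / η ^ 2) ^ 2 * (η ^ 2 * ‖u x‖ ^ 2 + ‖u' x‖ ^ 2)) :=
        mul_le_mul_of_nonneg_left (hB x hx s hsS hxc hse.ge) (Real.exp_pos _).le
      _ = (Φ / η ^ 2) ^ 2 * Real.exp (2 * η * (β - α)) * (η ^ 2 * ‖u x‖ ^ 2 + ‖u' x‖ ^ 2) := by
        ring
  · -- block–block
    calc η ^ 2 * ‖u y‖ ^ 2 + ‖u' y‖ ^ 2
        ≤ (Φ / η ^ 2) ^ 2 * (η ^ 2 * ‖u x‖ ^ 2 + ‖u' x‖ ^ 2) := hB x hx y hy hxc hyc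
      _ ≤ (Φ / η ^ 2) ^ 2 * Real.exp (2 * η * (β - α)) * (η ^ 2 * ‖u x‖ ^ 2 + ‖u' x‖ ^ 2) :=
        mul_le_mul_of_nonneg_right (le_mul_of_one_le_right hR0 hexp1) (hE0 x)

/-! ### Finitely many monotone pieces -/

/-- **Transport of the `η`-energy across a tame zone.** Let `t 0 ≤ t 1 ≤ ⋯ ≤ t k` be a partition
of `[t 0, t k]`, let `u″ = −φ u` on `[t 0, t k]` with `φ` differentiable and `−η² ≤ φ ≤ Φ` there
(`0 < η`, `η² ≤ Φ`), and suppose `φ` is monotone (non-decreasing or non-increasing) on each piece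
`[t i, t (i+1)]`, `i < k`. Then for any two points `x, y ∈ [t 0, t k]` the `η`-energy
`E = η²|u|² + |u′|²` satisfies `E(y) ≤ (Φ/η²)^{2k} · e^{2η (t k − t 0)} · E(x)`: each piece costs
at most the factor `(Φ/η²)² e^{2η (t (i+1) − t i)} ≥ 1`
(`etaEnergy_le_of_monotoneOn_or_antitoneOn`), by induction on the number of pieces through the
partition points. For `k = 0` the interval is a
point and the bound is an equality. [folklore] -/
theorem tameZone_transport {u u' : ℝ → ℂ} {φ φ' : ℝ → ℝ} {η Φ : ℝ} {k : ℕ} (t : ℕ → ℝ)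
    (ht : ∀ i < k, t i ≤ t (i + 1))
    (hu : ∀ x ∈ Icc (t 0) (t k), HasDerivAt u (u' x) x ∧ HasDerivAt u' (-((φ x : ℂ) * u x)) x)
    (hφ : ∀ x ∈ Icc (t 0) (t k), HasDerivAt φ (φ' x) x)
    (hmono : ∀ i < k, MonotoneOn φ (Icc (t i) (t (i + 1))) ∨ AntitoneOn φ (Icc (t i) (t (i + 1))))
    (hη : 0 < η) (hΦ : η ^ 2 ≤ Φ) (hbd : ∀ x ∈ Icc (t 0) (t k), -η ^ 2 ≤ φ x ∧ φ x ≤ Φ)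
    {x y : ℝ} (hx : x ∈ Icc (t 0) (t k)) (hy : y ∈ Icc (t 0) (t k)) :
    η ^ 2 * ‖u y‖ ^ 2 + ‖u' y‖ ^ 2 ≤
      (Φ / η ^ 2) ^ (2 * k) * Real.exp (2 * η * (t k - t 0)) *
        (η ^ 2 * ‖u x‖ ^ 2 + ‖u' x‖ ^ 2) := by
  -- the partition is monotone up to `k`
  have htm : ∀ j ≤ k, ∀ i ≤ j, t i ≤ t j := by
    intro j
    induction j with
    | zero => intro _ i hi; rw [Nat.le_zero.1 hi]
    | succ j ih =>
      intro hj i hi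
      rcases Nat.of_le_succ hi with h | h
      · exact (ih (Nat.le_of_succ_le hj) i h).trans (ht j hj)
      · rw [h]
  -- the ratio is `≥ 1`, energies are `≥ 0`
  have hR : 1 ≤ Φ / η ^ 2 := (one_le_div (pow_pos hη 2)).2 hΦ
  have hE0 : ∀ z, 0 ≤ η ^ 2 * ‖u z‖ ^ 2 + ‖u' z‖ ^ 2 := fun z => by positivity
  -- one piece of the partition
  have hone : ∀ i < k, ∀ a ∈ Icc (t i) (t (i + 1)), ∀ b ∈ Icc (t i) (t (i + 1)),
      η ^ 2 * ‖u b‖ ^ 2 + ‖u' b‖ ^ 2 ≤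
        (Φ / η ^ 2) ^ 2 * Real.exp (2 * η * (t (i + 1) - t i)) *
          (η ^ 2 * ‖u a‖ ^ 2 + ‖u' a‖ ^ 2) := by
    intro i hi a ha b hb
    have hsub : Icc (t i) (t (i + 1)) ⊆ Icc (t 0) (t k) :=
      Icc_subset_Icc (htm i hi.le 0 (Nat.zero_le i)) (htm k le_rfl (i + 1) hi)
    exact etaEnergy_le_of_monotoneOn_or_antitoneOn (fun z hz => hu z (hsub hz))
      (fun z hz => hφ z (hsub hz)) (hmono i hi) hη hΦ (fun z hz => hbd z (hsub hz)) ha hb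
  -- induction on the number of pieces
  have key : ∀ n ≤ k, ∀ a ∈ Icc (t 0) (t n), ∀ b ∈ Icc (t 0) (t n),
      η ^ 2 * ‖u b‖ ^ 2 + ‖u' b‖ ^ 2 ≤
        (Φ / η ^ 2) ^ (2 * n) * Real.exp (2 * η * (t n - t 0)) *
          (η ^ 2 * ‖u a‖ ^ 2 + ‖u' a‖ ^ 2) := by
    intro n
    induction n with
    | zero =>
      intro _ a ha b hb
      have hab : a = b := le_antisymm (ha.2.trans hb.1) (hb.2.trans ha.1)
      subst hab
      rw [mul_zero, pow_zero, sub_self, mul_zero, Real.exp_zero, one_mul, one_mul]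
    | succ n ih =>
      intro hn a ha b hb
      have hn' : n < k := hn
      have h0n : t 0 ≤ t n := htm n hn'.le 0 (Nat.zero_le n)
      have hnn : t n ≤ t (n + 1) := ht n hn'
      have hs : t n ∈ Icc (t 0) (t n) := right_mem_Icc.2 h0n
      have hs' : t n ∈ Icc (t n) (t (n + 1)) := left_mem_Icc.2 hnn
      -- the accumulated constant `C n`, the piece constant `c n`, and `C (n+1) = c n * C n`
      set Cn := (Φ / η ^ 2) ^ (2 * n) * Real.exp (2 * η * (t n - t 0)) with hCn_def
      set cn := (Φ / η ^ 2) ^ 2 * Real.exp (2 * η * (t (n + 1) - t n)) with hcn_def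
      have hCn : 1 ≤ Cn := one_le_mul_of_one_le_of_one_le (one_le_pow₀ hR)
        (Real.one_le_exp (mul_nonneg (by positivity) (sub_nonneg.2 h0n)))
      have hcn : 1 ≤ cn := one_le_mul_of_one_le_of_one_le (one_le_pow₀ hR)
        (Real.one_le_exp (mul_nonneg (by positivity) (sub_nonneg.2 hnn)))
      have hCn0 : 0 ≤ Cn := zero_le_one.trans hCn
      have hcn0 : 0 ≤ cn := zero_le_one.trans hcn
      have hmul : (Φ / η ^ 2) ^ (2 * (n + 1)) * Real.exp (2 * η * (t (n + 1) - t 0)) =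
          cn * Cn := by
        rw [hcn_def, hCn_def, show 2 * (n + 1) = 2 * n + 2 by ring, pow_add,
          show 2 * η * (t (n + 1) - t 0) = 2 * η * (t (n + 1) - t n) + 2 * η * (t n - t 0) by
            ring, Real.exp_add]
        ring
      rw [hmul]
      have hEa : 0 ≤ η ^ 2 * ‖u a‖ ^ 2 + ‖u' a‖ ^ 2 := hE0 a
      rcases le_total a (t n) with has | hsa <;> rcases le_total b (t n) with hbs | hsb
      · -- both points in `[t 0, t n]`
        calc η ^ 2 * ‖u b‖ ^ 2 + ‖u' b‖ ^ 2
            ≤ Cn * (η ^ 2 * ‖u a‖ ^ 2 + ‖u' a‖ ^ 2) := ih hn'.le a ⟨ha.1, has⟩ b ⟨hb.1, hbs⟩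
          _ ≤ cn * Cn * (η ^ 2 * ‖u a‖ ^ 2 + ‖u' a‖ ^ 2) :=
            mul_le_mul_of_nonneg_right (le_mul_of_one_le_left hCn0 hcn) hEa
      · -- `a ≤ t n ≤ b`: induction up to `t n`, then the last piece
        calc η ^ 2 * ‖u b‖ ^ 2 + ‖u' b‖ ^ 2
            ≤ cn * (η ^ 2 * ‖u (t n)‖ ^ 2 + ‖u' (t n)‖ ^ 2) :=
              hone n hn' (t n) hs' b ⟨hsb, hb.2⟩
          _ ≤ cn * (Cn * (η ^ 2 * ‖u a‖ ^ 2 + ‖u' a‖ ^ 2)) :=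
              mul_le_mul_of_nonneg_left (ih hn'.le a ⟨ha.1, has⟩ (t n) hs) hcn0
          _ = cn * Cn * (η ^ 2 * ‖u a‖ ^ 2 + ‖u' a‖ ^ 2) := by ring
      · -- `b ≤ t n ≤ a`: the last piece down to `t n`, then induction
        calc η ^ 2 * ‖u b‖ ^ 2 + ‖u' b‖ ^ 2
            ≤ Cn * (η ^ 2 * ‖u (t n)‖ ^ 2 + ‖u' (t n)‖ ^ 2) := ih hn'.le (t n) hs b ⟨hb.1, hbs⟩
          _ ≤ Cn * (cn * (η ^ 2 * ‖u a‖ ^ 2 + ‖u' a‖ ^ 2)) :=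
              mul_le_mul_of_nonneg_left (hone n hn' a ⟨hsa, ha.2⟩ (t n) hs') hCn0
          _ = cn * Cn * (η ^ 2 * ‖u a‖ ^ 2 + ‖u' a‖ ^ 2) := by ring
      · -- both points in the last piece
        calc η ^ 2 * ‖u b‖ ^ 2 + ‖u' b‖ ^ 2
            ≤ cn * (η ^ 2 * ‖u a‖ ^ 2 + ‖u' a‖ ^ 2) := hone n hn' a ⟨hsa, ha.2⟩ b ⟨hsb, hb.2⟩
          _ ≤ cn * Cn * (η ^ 2 * ‖u a‖ ^ 2 + ‖u' a‖ ^ 2) :=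
            mul_le_mul_of_nonneg_right (le_mul_of_one_le_right hcn0 hCn) hEa
  exact key k le_rfl x hx y hy

end Literature.Analysis.ODE

end
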